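import Literature.Analysis.PDE.SymmetricHyperbolicDerived
import Literature.Analysis.PDE.MollifierCommutator
import Literature.Analysis.ODE.GlobalExistence
import HarnessLib

/-!
# The regularised quasilinear field `U ↦ -J_δ[Σⱼ aⱼ(J_δU) ∂ⱼJ_δU + b(J_δU)]` on `L²` and its flow

Brick B-γ, §§2–3, of the Kato existence programme for the symmetrizable branch of Rauch's Local
Existence Theorem (towards `Rauch1986_smallAmplitudeExpansionL2`): Friedrichs' regularisation of
the cut-off quasilinear system `∂ₜy + Σⱼ aⱼ(y)∂ⱼy + b(y) = 0`, `y = u - ū` [Majda1984, Ch. 2,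
§2.1, (2.6)], [TaylorPDEIII2011, Ch. 16, (1.9)], as an ODE on `X = L²(ℝᵈ; W)`,
`W = EuclideanSpace ℝ (Fin k)`:

  `U' = F_δ(U) := -J_δ G(J_δU)`,  `G(w) := Σⱼ aⱼ(w) ∂ⱼw + b(w)`,

for operator fields `aⱼ : W → (W →L W)` and `b : W → W` which are `C¹`, with `‖aⱼ‖, ‖Daⱼ‖ ≤ M`,
`b(0) = 0`, `‖Db‖ ≤ L` (`IsTameCoeff`; the fields of the normalised cut-off system,
`NoBVEstimatesMultiDCoeffFields.lean`, are of this kind). With the tree's mollifier layer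
(`smoothRep`, `mollL2`, `l2norm_fderiv_convolution_moll_le`) this file proves:

* `memLp_gfield` — `G(J_δU) ∈ L²` with the **linear growth** `‖G(J_δU)‖₂ ≤ Λ_δ ‖U‖`
  (`Λ_δ = M Σⱼ C₁(j)/δ + L`);
* `l2norm_gfield_sub_le` — **local Lipschitz bound**
  `‖G(J_δU) - G(J_δU')‖₂ ≤ (Λ_δ + M ‖ρ_δ‖₂ (Σⱼ C₁(j)/δ) ‖U'‖) ‖U - U'‖`;
* `regField` — `F_δ : X → X`, `norm_regField_le` (linear growth), `lipschitzOnWith_regField`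
  (Lipschitz on balls);
* `exists_regularised_flow` — **for every `δ > 0` and `U₀ ∈ X` the regularised equation has a
  global forward solution** `U ∈ C¹([0, T]; X)` for all `T`, `U(0) = U₀` (the continuation
  principle `exists_solution_of_apriori_bound` with Grönwall's bound from the linear growth).

Everything is proved; no named fact and no `sorry` is introduced.

## References

* [Majda1984] A. Majda, *Compressible Fluid Flow and Systems of Conservation Laws in Several
  Space Variables* (1984), Ch. 2, §2.1.
* [TaylorPDEIII2011] M. E. Taylor, *Partial Differential Equations III*, 2nd ed. (2011), Ch. 16,
  §1, (1.9)–(1.15).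
* [Friedrichs1954] K. O. Friedrichs, Comm. Pure Appl. Math. 7 (1954) 345–392, §3.
-/

noncomputable section

open MeasureTheory Set Function Filter Metric ContinuousLinearMap
open scoped ContDiff Topology ENNReal NNReal Convolution

namespace Literature.Barriers.AtomisticToContinuum

open Literature.Analysis.PDE Literature.Analysis.FunctionSpaces Literature.Analysis.ODE

variable {d k : ℕ}

/-- Shorthand: the state Hilbert space `W = ℝᵏ`. -/
local notation "W" k => EuclideanSpace ℝ (Fin k)
/-- Shorthand: physical space `ℝᵈ`. -/
local notation "E" d => EuclideanSpace ℝ (Fin d)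

/-! ### Tame coefficient fields -/

/-- **Tame coefficients**: `aⱼ, b` are `C¹`, `‖aⱼ(y)‖ ≤ M`, `‖Daⱼ(y)‖ ≤ M`, `b(0) = 0`,
`‖Db(y)‖ ≤ L` (the normalised cut-off coefficients of a symmetrizable system are tame).
[cite: Majda1984, Ch. 2 §2.1] -/
structure IsTameCoeff (M L : ℝ) (a : Fin d → (W k) → ((W k) →L[ℝ] (W k))) (b : (W k) → (W k)) :
    Prop where
  contDiff_a : ∀ j, ContDiff ℝ 1 (a j)
  contDiff_b : ContDiff ℝ 1 b
  norm_a : ∀ j y, ‖a j y‖ ≤ M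
  norm_fderiv_a : ∀ j y, ‖fderiv ℝ (a j) y‖ ≤ M
  b_zero : b 0 = 0
  norm_fderiv_b : ∀ y, ‖fderiv ℝ b y‖ ≤ L
  M_nonneg : 0 ≤ M
  L_nonneg : 0 ≤ L

namespace IsTameCoeff

variable {M L : ℝ} {a : Fin d → (W k) → ((W k) →L[ℝ] (W k))} {b : (W k) → (W k)}

/-- `aⱼ` is `M`-Lipschitz. [folklore] -/
theorem norm_a_sub_le (h : IsTameCoeff M L a b) (j : Fin d) (y y' : W k) :
    ‖a j y - a j y'‖ ≤ M * ‖y - y'‖ :=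
  (convex_univ).norm_image_sub_le_of_norm_fderiv_le
    (fun z _ => ((h.contDiff_a j).differentiable one_ne_zero) z) (fun z _ => h.norm_fderiv_a j z)
    (mem_univ y') (mem_univ y)

/-- `b` is `L`-Lipschitz. [folklore] -/
theorem norm_b_sub_le (h : IsTameCoeff M L a b) (y y' : W k) : ‖b y - b y'‖ ≤ L * ‖y - y'‖ :=
  (convex_univ).norm_image_sub_le_of_norm_fderiv_le
    (fun z _ => (h.contDiff_b.differentiable one_ne_zero) z) (fun z _ => h.norm_fderiv_b z)
    (mem_univ y') (mem_univ y)

/-- `‖b(y)‖ ≤ L‖y‖`. [folklore] -/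
theorem norm_b_le (h : IsTameCoeff M L a b) (y : W k) : ‖b y‖ ≤ L * ‖y‖ := by
  simpa [h.b_zero] using h.norm_b_sub_le y 0

end IsTameCoeff

/-! ### The nonlinear first-order field `G(w) = Σⱼ aⱼ(w) ∂ⱼw + b(w)` -/

/-- `G(w)(x) = Σⱼ aⱼ(w x) (∂ⱼ w)(x) + b(w x)`. [cite: Majda1984, Ch. 2 §2.1] -/
def gfield (a : Fin d → (W k) → ((W k) →L[ℝ] (W k))) (b : (W k) → (W k)) (w : (E d) → (W k)) :
    (E d) → (W k) :=
  fun x => ∑ j, a j (w x) (cwd [j] w x) + b (w x)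

section GField

variable {M L : ℝ} {a : Fin d → (W k) → ((W k) →L[ℝ] (W k))} {b : (W k) → (W k)}

/-- `G(w)` is continuous for smooth `w`. [folklore] -/
theorem continuous_gfield (h : IsTameCoeff M L a b) {w : (E d) → (W k)} (hw : ContDiff ℝ ∞ w) :
    Continuous (gfield a b w) := by
  refine (continuous_finsetSum _ fun j _ => ?_).add (h.contDiff_b.continuous.comp hw.continuous)
  exact ((h.contDiff_a j).continuous.comp hw.continuous).clm_apply (continuous_cwd hw [j])

/-- **`G(w) ∈ L²` with `‖G(w)‖₂ ≤ M Σⱼ ‖∂ⱼw‖₂ + L ‖w‖₂`** for a smooth `w` with `w, ∂ⱼw ∈ L²`.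
[cite: Majda1984, Ch. 2 §2.1] -/
theorem memLp_gfield_of (h : IsTameCoeff M L a b) {w : (E d) → (W k)} (hw : ContDiff ℝ ∞ w)
    (hw2 : MemLp w 2 (volume : Measure (E d)))
    (hwj : ∀ j, MemLp (cwd [j] w) 2 (volume : Measure (E d))) :
    MemLp (gfield a b w) 2 (volume : Measure (E d)) ∧
      l2norm (gfield a b w) ≤ M * ∑ j, l2norm (cwd [j] w) + L * l2norm w := by
  -- the transport terms
  have hT : ∀ j, MemLp (fun x => a j (w x) (cwd [j] w x)) 2 (volume : Measure (E d)) ∧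
      l2norm (fun x => a j (w x) (cwd [j] w x)) ≤ M * l2norm (cwd [j] w) := fun j =>
    memLp_clm_apply_and_l2norm_le ((h.contDiff_a j).continuous.comp hw.continuous)
      (continuous_cwd hw [j]) (hwj j) h.M_nonneg (fun x => h.norm_a j (w x))
  -- the zeroth-order term
  have hB : MemLp (fun x => b (w x)) 2 (volume : Measure (E d)) ∧
      l2norm (fun x => b (w x)) ≤ L * l2norm w :=
    memLp_and_l2norm_le_of_le (h.contDiff_b.continuous.comp hw.continuous) hw2 h.L_nonneg
      (fun x => h.norm_b_le (w x))
  have hS : MemLp (fun x => ∑ j, a j (w x) (cwd [j] w x)) 2 (volume : Measure (E d)) ∧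
      l2norm (fun x => ∑ j, a j (w x) (cwd [j] w x)) ≤ ∑ j, M * l2norm (cwd [j] w) := by
    induction (Finset.univ : Finset (Fin d)) using Finset.induction_on with
    | empty =>
      refine ⟨by simp, ?_⟩
      simp [l2norm_def]
    | insert j s hj ih =>
      obtain ⟨ihm, ihle⟩ := ih
      simp_rw [Finset.sum_insert hj]
      refine ⟨(hT j).1.add ihm, ?_⟩
      calc l2norm (fun x => a j (w x) (cwd [j] w x) + ∑ i ∈ s, a i (w x) (cwd [i] w x))
          ≤ l2norm (fun x => a j (w x) (cwd [j] w x)) + l2norm (fun x => ∑ i ∈ s, a i (w x) (cwd [i] w x)) :=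
            l2norm_add_le (hT j).1 ihm
        _ ≤ M * l2norm (cwd [j] w) + ∑ i ∈ s, M * l2norm (cwd [i] w) := add_le_add (hT j).2 ihle
  refine ⟨hS.1.add hB.1, ?_⟩
  calc l2norm (gfield a b w) ≤ l2norm (fun x => ∑ j, a j (w x) (cwd [j] w x)) + l2norm (fun x => b (w x)) :=
        l2norm_add_le hS.1 hB.1
    _ ≤ ∑ j, M * l2norm (cwd [j] w) + L * l2norm w := add_le_add hS.2 hB.2
    _ = M * ∑ j, l2norm (cwd [j] w) + L * l2norm w := by rw [Finset.mul_sum]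

/-- Finite sums in `L²`: memberships and norm bounds add up. [folklore] -/
theorem memLp_sum_and_l2norm_le {ι' : Type*} (s : Finset ι') {f : ι' → (E d) → (W k)} {c : ι' → ℝ}
    (hf : ∀ i ∈ s, MemLp (f i) 2 (volume : Measure (E d)) ∧ l2norm (f i) ≤ c i) :
    MemLp (fun x => ∑ i ∈ s, f i x) 2 (volume : Measure (E d)) ∧
      l2norm (fun x => ∑ i ∈ s, f i x) ≤ ∑ i ∈ s, c i := by
  classical
  induction s using Finset.induction_on with
  | empty => exact ⟨by simp, by simp [l2norm_def]⟩
  | insert j s hj ih =>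
    obtain ⟨ihm, ihle⟩ := ih fun i hi => hf i (Finset.mem_insert_of_mem hi)
    obtain ⟨hjm, hjle⟩ := hf j (Finset.mem_insert_self j s)
    simp_rw [Finset.sum_insert hj]
    refine ⟨hjm.add ihm, ?_⟩
    exact (l2norm_add_le hjm ihm).trans (add_le_add hjle ihle)

end GField

/-! ### `G` on smooth representatives `w = ρ_δ ⋆ U` -/

section OnRep

variable {M L : ℝ} {a : Fin d → (W k) → ((W k) →L[ℝ] (W k))} {b : (W k) → (W k)}

/-- The derivative constant `Σⱼ C₁(j)/δ` of the mollifier of scale `δ`. [folklore] -/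
def derivCost (d : ℕ) (δ : ℝ) : ℝ := ∑ j : Fin d, mollDerivConst (Fin d) (bv j) / δ

/-- `0 ≤ Σⱼ C₁(j)/δ` for `δ > 0`. [folklore] -/
theorem derivCost_nonneg (d : ℕ) {δ : ℝ} (hδ : 0 < δ) : 0 ≤ derivCost d δ :=
  Finset.sum_nonneg fun _ _ => div_nonneg (mollDerivConst_nonneg _) hδ.le

/-- **The linear-growth constant** `Λ_δ = M Σⱼ C₁(j)/δ + L`. [folklore] -/
def growth (M L : ℝ) (d : ℕ) (δ : ℝ) : ℝ := M * derivCost d δ + L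

/-- `‖∂ⱼ(ρ_δ ⋆ U)‖₂ ≤ (C₁(j)/δ) ‖U‖`. [folklore] -/
theorem l2norm_cwd_smoothRep_moll_le {δ : ℝ} (hδ : 0 < δ) (U : Lp (W k) 2 (volume : Measure (E d)))
    (j : Fin d) :
    MemLp (cwd [j] (smoothRep (moll (Fin d) hδ) U)) 2 (volume : Measure (E d)) ∧
      l2norm (cwd [j] (smoothRep (moll (Fin d) hδ) U)) ≤ mollDerivConst (Fin d) (bv j) / δ * ‖U‖ := by
  have h := l2norm_fderiv_convolution_moll_le (ι := Fin d) δ hδ (Lp.memLp U) (bv j)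
  rw [cwd_singleton, smoothRep_def, Lp.norm_def, ← l2norm_def]
  exact h

/-- `‖ρ_δ ⋆ U‖₂ ≤ ‖U‖`. [folklore] -/
theorem l2norm_smoothRep_moll_le {δ : ℝ} (hδ : 0 < δ) (U : Lp (W k) 2 (volume : Measure (E d))) :
    MemLp (smoothRep (moll (Fin d) hδ) U) 2 (volume : Measure (E d)) ∧
      l2norm (smoothRep (moll (Fin d) hδ) U) ≤ ‖U‖ := by
  obtain ⟨hm, hle⟩ := memLp_smoothRep (continuous_moll hδ) (hasCompactSupport_moll hδ) U
  have hmass : ∫ y, |moll (Fin d) hδ y| = 1 := by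
    rw [show (fun y => |moll (Fin d) hδ y|) = moll (Fin d) hδ from
      funext fun y => abs_of_nonneg (moll_nonneg hδ y)]
    exact integral_moll hδ
  rw [hmass, one_mul] at hle
  exact ⟨hm, hle⟩

/-- **Sup bound**: `‖(ρ_δ ⋆ U)(x)‖ ≤ ‖ρ_δ‖₂ ‖U‖`. [folklore] -/
theorem norm_smoothRep_moll_le {δ : ℝ} (hδ : 0 < δ) (U : Lp (W k) 2 (volume : Measure (E d)))
    (x : E d) : ‖smoothRep (moll (Fin d) hδ) U x‖ ≤ l2norm (moll (Fin d) hδ) * ‖U‖ := by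
  simpa [cwd_nil] using norm_cwd_smoothRep_le (contDiff_moll hδ) (hasCompactSupport_moll hδ) U [] x

/-- **Linear growth**: `G(ρ_δ ⋆ U) ∈ L²` with `‖G(ρ_δ ⋆ U)‖₂ ≤ Λ_δ ‖U‖`.
[cite: Majda1984, Ch. 2 §2.1] -/
theorem memLp_gfield_smoothRep (h : IsTameCoeff M L a b) {δ : ℝ} (hδ : 0 < δ)
    (U : Lp (W k) 2 (volume : Measure (E d))) :
    MemLp (gfield a b (smoothRep (moll (Fin d) hδ) U)) 2 (volume : Measure (E d)) ∧
      l2norm (gfield a b (smoothRep (moll (Fin d) hδ) U)) ≤ growth M L d δ * ‖U‖ := by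
  obtain ⟨hm, hle⟩ := memLp_gfield_of h (contDiff_smoothRep (contDiff_moll hδ) (hasCompactSupport_moll hδ) U)
    (l2norm_smoothRep_moll_le hδ U).1 (fun j => (l2norm_cwd_smoothRep_moll_le hδ U j).1)
  refine ⟨hm, hle.trans ?_⟩
  have h1 : ∑ j, l2norm (cwd [j] (smoothRep (moll (Fin d) hδ) U)) ≤ derivCost d δ * ‖U‖ := by
    rw [derivCost, Finset.sum_mul]
    exact Finset.sum_le_sum fun j _ => (l2norm_cwd_smoothRep_moll_le hδ U j).2
  have h2 := (l2norm_smoothRep_moll_le hδ U).2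
  rw [growth]
  nlinarith [mul_le_mul_of_nonneg_left h1 h.M_nonneg, mul_le_mul_of_nonneg_left h2 h.L_nonneg]

/-- **Local Lipschitz bound**:
`‖G(ρ_δ ⋆ U) - G(ρ_δ ⋆ U')‖₂ ≤ (Λ_δ + M ‖ρ_δ‖₂ (Σⱼ C₁(j)/δ) ‖U'‖) ‖U - U'‖`.
[cite: Majda1984, Ch. 2 §2.1] -/
theorem l2norm_gfield_smoothRep_sub_le (h : IsTameCoeff M L a b) {δ : ℝ} (hδ : 0 < δ)
    (U U' : Lp (W k) 2 (volume : Measure (E d))) :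
    MemLp (fun x => gfield a b (smoothRep (moll (Fin d) hδ) U) x -
        gfield a b (smoothRep (moll (Fin d) hδ) U') x) 2 (volume : Measure (E d)) ∧
      l2norm (fun x => gfield a b (smoothRep (moll (Fin d) hδ) U) x -
        gfield a b (smoothRep (moll (Fin d) hδ) U') x) ≤
        (growth M L d δ + M * l2norm (moll (Fin d) hδ) * derivCost d δ * ‖U'‖) * ‖U - U'‖ := by
  set ρ := moll (Fin d) hδ with hρdef
  have hρ : ContDiff ℝ ∞ ρ := contDiff_moll hδ
  have hρc : HasCompactSupport ρ := hasCompactSupport_moll hδ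
  set w := smoothRep ρ U with hw
  set w' := smoothRep ρ U' with hw'
  have hws : ContDiff ℝ ∞ w := contDiff_smoothRep hρ hρc U
  have hws' : ContDiff ℝ ∞ w' := contDiff_smoothRep hρ hρc U'
  -- `w - w'` is the representative of `U - U'`
  have hsub : smoothRep ρ (U - U') = fun x => w x - w' x := by
    rw [smoothRep_sub ρ hρ.continuous hρc U U']
    rfl
  have hcwd_sub : ∀ j x, cwd [j] (smoothRep ρ (U - U')) x = cwd [j] w x - cwd [j] w' x := by
    intro j x
    rw [hsub, cwd_singleton, cwd_singleton, cwd_singleton]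
    dsimp only
    rw [fderiv_fun_sub (hws.differentiable (by simp) x) (hws'.differentiable (by simp) x)]
    rfl
  have hUU := l2norm_smoothRep_moll_le hδ (U - U')
  have hUUj := fun j => l2norm_cwd_smoothRep_moll_le hδ (U - U') j
  have hU'j := fun j => l2norm_cwd_smoothRep_moll_le hδ U' j
  -- the sup bound for `w - w'`
  set η := l2norm ρ * ‖U - U'‖ with hη
  have hη0 : 0 ≤ η := mul_nonneg (l2norm_nonneg _) (norm_nonneg _)
  have hsup : ∀ x, ‖w x - w' x‖ ≤ η := by
    intro x
    have hx := norm_smoothRep_moll_le hδ (U - U') x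
    rwa [← hρdef, hsub] at hx
  -- the three kinds of terms
  have hT1 : ∀ j, MemLp (fun x => a j (w x) (cwd [j] (smoothRep ρ (U - U')) x)) 2 (volume : Measure (E d)) ∧
      l2norm (fun x => a j (w x) (cwd [j] (smoothRep ρ (U - U')) x)) ≤
        M * (mollDerivConst (Fin d) (bv j) / δ * ‖U - U'‖) := by
    intro j
    obtain ⟨hm, hle⟩ := memLp_clm_apply_and_l2norm_le ((h.contDiff_a j).continuous.comp hws.continuous)
      (continuous_cwd (contDiff_smoothRep hρ hρc (U - U')) [j]) (hUUj j).1 h.M_nonneg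
      (fun x => h.norm_a j (w x))
    exact ⟨hm, hle.trans (mul_le_mul_of_nonneg_left (hUUj j).2 h.M_nonneg)⟩
  have hT2 : ∀ j, MemLp (fun x => (a j (w x) - a j (w' x)) (cwd [j] w' x)) 2 (volume : Measure (E d)) ∧
      l2norm (fun x => (a j (w x) - a j (w' x)) (cwd [j] w' x)) ≤
        M * η * (mollDerivConst (Fin d) (bv j) / δ * ‖U'‖) := by
    intro j
    obtain ⟨hm, hle⟩ := memLp_clm_apply_and_l2norm_le
      (((h.contDiff_a j).continuous.comp hws.continuous).sub
        ((h.contDiff_a j).continuous.comp hws'.continuous))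
      (continuous_cwd hws' [j]) (hU'j j).1 (mul_nonneg h.M_nonneg hη0)
      (fun x => (h.norm_a_sub_le j (w x) (w' x)).trans (mul_le_mul_of_nonneg_left (hsup x) h.M_nonneg))
    exact ⟨hm, hle.trans (mul_le_mul_of_nonneg_left (hU'j j).2 (mul_nonneg h.M_nonneg hη0))⟩
  have hT3 : MemLp (fun x => b (w x) - b (w' x)) 2 (volume : Measure (E d)) ∧
      l2norm (fun x => b (w x) - b (w' x)) ≤ L * ‖U - U'‖ := by
    obtain ⟨hm, hle⟩ := memLp_and_l2norm_le_of_le (g := smoothRep ρ (U - U'))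
      ((h.contDiff_b.continuous.comp hws.continuous).sub (h.contDiff_b.continuous.comp hws'.continuous))
      hUU.1 h.L_nonneg (fun x => by
        rw [hsub]
        exact h.norm_b_sub_le (w x) (w' x))
    exact ⟨hm, hle.trans (mul_le_mul_of_nonneg_left hUU.2 h.L_nonneg)⟩
  -- the sum of the transport terms
  have hT12 : ∀ j ∈ (Finset.univ : Finset (Fin d)),
      MemLp (fun x => a j (w x) (cwd [j] (smoothRep ρ (U - U')) x) + (a j (w x) - a j (w' x)) (cwd [j] w' x))
        2 (volume : Measure (E d)) ∧
      l2norm (fun x => a j (w x) (cwd [j] (smoothRep ρ (U - U')) x) + (a j (w x) - a j (w' x)) (cwd [j] w' x)) ≤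
        M * (mollDerivConst (Fin d) (bv j) / δ * ‖U - U'‖) + M * η * (mollDerivConst (Fin d) (bv j) / δ * ‖U'‖) :=
    fun j _ => ⟨(hT1 j).1.add (hT2 j).1, (l2norm_add_le (hT1 j).1 (hT2 j).1).trans (add_le_add (hT1 j).2 (hT2 j).2)⟩
  obtain ⟨hSm, hSle⟩ := memLp_sum_and_l2norm_le (Finset.univ : Finset (Fin d)) hT12
  -- the pointwise decomposition
  have hpt : (fun x => gfield a b w x - gfield a b w' x) = fun x =>
      (∑ j, (a j (w x) (cwd [j] (smoothRep ρ (U - U')) x) + (a j (w x) - a j (w' x)) (cwd [j] w' x))) +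
        (b (w x) - b (w' x)) := by
    funext x
    simp only [gfield, hcwd_sub, map_sub, FunLike.coe_sub, Pi.sub_apply,
      Finset.sum_add_distrib, Finset.sum_sub_distrib]
    abel
  rw [hpt]
  refine ⟨hSm.add hT3.1, ((l2norm_add_le hSm hT3.1).trans (add_le_add hSle hT3.2)).trans (le_of_eq ?_)⟩
  have e1 : ∑ x, M * (mollDerivConst (Fin d) (bv x) / δ * ‖U - U'‖) = derivCost d δ * (M * ‖U - U'‖) := by
    rw [derivCost, Finset.sum_mul]
    exact Finset.sum_congr rfl fun x _ => by ring
  have e2 : ∑ x, M * η * (mollDerivConst (Fin d) (bv x) / δ * ‖U'‖) = derivCost d δ * (M * η * ‖U'‖) := by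
    rw [derivCost, Finset.sum_mul]
    exact Finset.sum_congr rfl fun x _ => by ring
  rw [Finset.sum_add_distrib, e1, e2, growth, hη]
  ring

end OnRep

/-! ### The regularised field `F_δ` on `L²` and its global flow -/

section Flow

variable {M L : ℝ} {a : Fin d → (W k) → ((W k) →L[ℝ] (W k))} {b : (W k) → (W k)}

/-- **The regularised quasilinear field** `F_δ(U) = -J_δ G(ρ_δ ⋆ U)` on `L²(ℝᵈ; ℝᵏ)`.
[cite: Majda1984, Ch. 2 §2.1, (2.6)] -/
def regField (h : IsTameCoeff M L a b) {δ : ℝ} (hδ : 0 < δ) (U : Lp (W k) 2 (volume : Measure (E d))) :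
    Lp (W k) 2 (volume : Measure (E d)) :=
  -(mollL2 hδ ((memLp_gfield_smoothRep h hδ U).1.toLp _))

/-- **Linear growth of `F_δ`**: `‖F_δ(U)‖ ≤ Λ_δ ‖U‖`. [cite: Majda1984, Ch. 2 §2.1] -/
theorem norm_regField_le (h : IsTameCoeff M L a b) {δ : ℝ} (hδ : 0 < δ)
    (U : Lp (W k) 2 (volume : Measure (E d))) : ‖regField h hδ U‖ ≤ growth M L d δ * ‖U‖ := by
  rw [regField, norm_neg]
  refine (norm_mollL2_le hδ _).trans ?_
  rw [Lp.norm_toLp, ← l2norm_def]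
  exact (memLp_gfield_smoothRep h hδ U).2

/-- **`F_δ` is Lipschitz on balls**:
`‖F_δ(U) - F_δ(U')‖ ≤ (Λ_δ + M ‖ρ_δ‖₂ (Σⱼ C₁(j)/δ) ‖U'‖) ‖U - U'‖` (`J_δ` is a contraction).
[cite: Majda1984, Ch. 2 §2.1] -/
theorem norm_regField_sub_le (h : IsTameCoeff M L a b) {δ : ℝ} (hδ : 0 < δ)
    (U U' : Lp (W k) 2 (volume : Measure (E d))) :
    ‖regField h hδ U - regField h hδ U'‖ ≤
      (growth M L d δ + M * l2norm (moll (Fin d) hδ) * derivCost d δ * ‖U'‖) * ‖U - U'‖ := by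
  obtain ⟨hm, hle⟩ := l2norm_gfield_smoothRep_sub_le h hδ U U'
  rw [norm_sub_rev, regField, regField, neg_sub_neg, ← map_sub,
    ← MemLp.toLp_sub (memLp_gfield_smoothRep h hδ U).1 (memLp_gfield_smoothRep h hδ U').1]
  refine (norm_mollL2_le hδ _).trans ?_
  rw [Lp.norm_toLp, ← l2norm_def]
  exact hle

/-- `F_δ` is Lipschitz on every ball of `L²`. [folklore] -/
theorem lipschitzOnWith_regField (h : IsTameCoeff M L a b) {δ : ℝ} (hδ : 0 < δ) (R : ℝ) :
    LipschitzOnWith (Real.toNNReal (growth M L d δ + M * l2norm (moll (Fin d) hδ) * derivCost d δ * |R|))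
      (regField h hδ) (closedBall (0 : Lp (W k) 2 (volume : Measure (E d))) R) := by
  refine LipschitzOnWith.of_dist_le_mul fun U hU U' hU' => ?_
  rw [dist_eq_norm, dist_eq_norm]
  have hU'R : ‖U'‖ ≤ |R| := by
    rw [mem_closedBall, dist_zero_right] at hU'
    exact hU'.trans (le_abs_self R)
  have hgrowth : 0 ≤ growth M L d δ :=
    add_nonneg (mul_nonneg h.M_nonneg (derivCost_nonneg d hδ)) h.L_nonneg
  have hc : 0 ≤ M * l2norm (moll (Fin d) hδ) * derivCost d δ :=
    mul_nonneg (mul_nonneg h.M_nonneg (l2norm_nonneg _)) (derivCost_nonneg d hδ)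
  refine (norm_regField_sub_le h hδ U U').trans ?_
  rw [Real.coe_toNNReal _ (add_nonneg hgrowth (mul_nonneg hc (abs_nonneg R)))]
  exact mul_le_mul_of_nonneg_right (add_le_add_right (mul_le_mul_of_nonneg_left hU'R hc) _) (norm_nonneg _)

/-- **Global forward flow of the regularised quasilinear equation.** For every `δ > 0` and every
`U₀ ∈ L²(ℝᵈ; ℝᵏ)` there is `U : [0, ∞) → L²` with `U(0) = U₀` and `U' = F_δ(U)` on every `[0, T]`
(the continuation principle with Grönwall's a priori bound `‖U(t)‖ ≤ ‖U₀‖ e^{Λ_δ t}` from the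
linear growth of `F_δ`). [cite: Majda1984, Ch. 2 §2.1]; [cite: TaylorPDEIII2011, Ch. 16 §1] -/
theorem exists_regularised_flow (h : IsTameCoeff M L a b) {δ : ℝ} (hδ : 0 < δ)
    (U₀ : Lp (W k) 2 (volume : Measure (E d))) :
    ∃ U : ℝ → Lp (W k) 2 (volume : Measure (E d)), U 0 = U₀ ∧
      ∀ T, ∀ t ∈ Icc 0 T, HasDerivWithinAt U (regField h hδ (U t)) (Icc 0 T) t := by
  set K : ℝ := growth M L d δ with hK
  have hK0 : 0 ≤ K := add_nonneg (mul_nonneg h.M_nonneg (derivCost_nonneg d hδ)) h.L_nonneg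
  refine exists_solution_of_apriori_bound (v := fun _ => regField h hδ) (x₀ := U₀)
    (fun T R => ⟨_, fun t _ => lipschitzOnWith_regField h hδ R⟩) (fun x => continuousOn_const) ?_
  intro T hT
  refine ⟨‖U₀‖ * Real.exp (K * T), ?_, fun s hs α hα0 hα t ht => ?_⟩
  · have : (1 : ℝ) ≤ Real.exp (K * T) := Real.one_le_exp (by positivity)
    nlinarith [norm_nonneg U₀]
  have hcontα : ContinuousOn α (Icc 0 s) := fun τ hτ => (hα τ hτ).continuousWithinAt
  have hder : ∀ τ ∈ Ico 0 s, HasDerivWithinAt α (regField h hδ (α τ)) (Ici τ) τ := fun τ hτ =>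
    (hα τ (Ico_subset_Icc_self hτ)).mono_of_mem_nhdsWithin
      (mem_of_superset (Icc_mem_nhdsGE hτ.2) (Icc_subset_Icc hτ.1 le_rfl))
  have hbound : ∀ τ ∈ Ico 0 s, ‖regField h hδ (α τ)‖ ≤ K * ‖α τ‖ + 0 := fun τ _ => by
    rw [add_zero]
    exact norm_regField_le h hδ (α τ)
  have hg := norm_le_gronwallBound_of_norm_deriv_right_le hcontα hder (le_of_eq (by rw [hα0]))
    hbound t ht
  rw [gronwallBound_ε0, sub_zero] at hg
  refine hg.trans ?_
  gcongr
  exact ht.2.trans hs.2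

end Flow

end Literature.Barriers.AtomisticToContinuum

end
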